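import Mathlib.NumberTheory.ZetaValues
import Literature.Barriers.KontsevichZagierPeriods.GrothendieckPeriodConjectureDependence
import Literature.NumberTheory.Transcendental.KZKernelConjectureForms
import Literature.NumberTheory.Transcendental.LindemannWeierstrassProofs
import HarnessLib

/-!
# Barrier (Kontsevich–Zagier): the odd-zeta strength barrier — status, reductions, proved frontier

Sibling proof file of `GrothendieckPeriodConjectureDependence.lean`, about its named fact
`Literature.Barriers.KontsevichZagierPeriods.kzConjecture_implies_oddZetaAlgIndep` ("the summit
implies that `ζ(3), ζ(5), ζ(7), …` are algebraically independent over `ℚ`":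
`A → AlgebraicIndependent ℚ (n ↦ ζ(2n+3))` with `A` the body of the summit
`KontsevichZagierPeriods`). Theorems only: no definition is added, no statement is changed, no
named fact is introduced (companions: `GrothendieckPeriodConjectureDependenceProofs.lean` for
`TwoPiILogAlgIndep`, `GrothendieckPeriodConjectureDependenceEllipticProofs.lean` for
`EllipticPeriodsAlgIndep`).

## Status of the fact (why there is no `kzConjecture_implies_oddZetaAlgIndep_holds`)

The fact is an implication `A → C` with

* `A` = Conjecture 1 of Kontsevich–Zagier over the calculus of `KZCalculus.lean` (the summit), an
  open problem with no refutation in the tree — "J'aurais du mal à imaginer une conjecture plus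
  désespérément hors de portée" [Fresan2024, §3.2];
* `C` = algebraic independence of `n ↦ ζ(2n+3)`, the `π`-free part of the open conjecture
  `Literature.NumberTheory.Transcendental.PiOddZetaAlgebraicIndependent` (periods.S21: "The
  numbers `π, ζ(3), ζ(5), …, ζ(2n+1), …` are algebraically independent over `ℚ`"
  [Waldschmidt2004, §3.2 Conj. 3.17]); Fresán prints `C` as a conjecture: "On conjecture que
  c'est aussi le cas [transcendance] pour les valeurs de la fonction zêta aux entiers impairs et
  même que, contrairement à ce qui précède, celles-ci ne sont pas algébriquement reliées au nombre
  `π`. Très peu de résultats sont connus dans cette direction, hormis l'irrationalité de `ζ(3)` …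
  et l'existence d'une infinité de nombres irrationnels parmi `ζ(5), ζ(7), …`"
  [Fresan2024, Ex. 2.6].

So a proof of the fact in this library is one of: a disproof of the summit, a proof of `C`, or a
formalisation of the printed implication, whose four stages use objects that neither Mathlib nor
the tree has (`Literature/AlgebraicGeometry/Motives/NoriInterface.lean` is an interface without a
classical instance):

1. rules form of Conjecture 1 ⟹ injectivity of the evaluation `per` on formal periods (symbols
   `[Hᵖ(X, D), ω, σ]` modulo additivity, change of variables, Stokes) — asserted without proof in
   [KontsevichZagier2001, §4.1]; "La conjecture de Kontsevich–Zagier se traduit alors en l'énoncé :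
   Conjecture 10.6 (Kontsevich–Zagier). L'application per est injective." [Fresan2024, §10.4];
   naive integral representations = periods of Nori motives is [HuberMullerStachPeriods2017,
   Thm. 12.2.1] (Fresán's Thm. 7.5);
2. `per` injective ⟺ the Grothendieck period conjecture for every Nori motive
   [HuberMullerStachPeriods2017, Prop. 13.2.6]; [Ayoub2014, Cor. 32]; [Fresan2024, §10.4: "on
   retrouve la conjecture 10.1"];
3. for mixed Tate motives over `ℤ` the periods are the multiple zeta values and "the motivic
   picture is completely understood" (Deligne–Goncharov, Terasoma, Brown)
   [HuberWustholz2022, Prologue p. xvii]; [Fresan2024, Ex. 2.6];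
4. Brown's structure theorem for motivic multiple zeta values: "`ζᵐ(2)` and `ζᵐ(2n+1)`, for
   `n ≥ 1`, are algebraically independent in `𝓗`" [Brown2012, §3.2], obtained "sans supposer la
   conjecture connue" [Fresan2024, §10.4].

Together: "The Period Conjecture implies that the `ζ(2n+1)` for `n ∈ ℕ` are algebraically
independent" [HuberWustholz2022, Prologue p. xvi] — the sentence vendored as the fact. Each stage
is a theory (Nori motives and their Tannakian groups, `MT(ℤ)`, motivic MZVs), so the discharge is
out of reach here and users keep the explicit hypothesis
`(h : kzConjecture_implies_oddZetaAlgIndep)`. This file records, sorry-free, where the fact sits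
and what IS proved around its consequent.

## What is proved here

Conditionally — the position of the fact:

* `kzConjecture_implies_oddZetaAlgIndep_of_piOddZetaAlgebraicIndependent` — the fact is implied
  outright by the open conjecture `PiOddZetaAlgebraicIndependent` (periods.S21; the consequent is
  its `π`-free sub-family, `PiOddZetaAlgebraicIndependent.algebraicIndependent_zetaValue_odd`):
  the named-fact debt is dominated by an open statement (CONVENTIONS §4).
* `kzConjecture_implies_oddZetaAlgIndep_iff_kernelForm`,
  `kzConjecture_implies_oddZetaAlgIndep_iff_algebraicForm` — the barrier is equivalently the same
  implication from the kernel form `KZKernelConjecture` (`ker eval = relations`: injectivity of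
  evaluation on formal combinations of integral representations modulo the moves — the shape of
  [HuberMullerStachPeriods2017, Conj. 13.2.1] and of Fresán's Conj. 10.6, where stage 1 starts)
  and from the all-algebraic two-representation form `KZPeriodConjecture'`, by the proved
  comparison lemmas of `KZKernelConjectureForms.lean`.
* `transcendental_zetaValue_odd_of_kz`, `oddZetaIrrational_of_kzKernel`,
  `zetaFiveIrrational_of_kzKernel` — the bite in these forms: with the fact, Conjecture 1 proves
  the transcendence of every `ζ(2k+1)`, `k ≥ 1` ("we do not even know the transcendence of a
  single odd zeta value" [FischlerSprangZudilin2019, §1]), hence `OddZetaIrrational` and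
  `ZetaFiveIrrational`.

Unconditionally — the proved part of [Fresan2024, Ex. 2.6], i.e. why the statement concerns the
odd values only:

* `zetaValue_two_mul_eq`, `zetaValue_two_mul_pos`, `exists_rat_ne_zero_zetaValue_two_mul_eq` —
  Euler: `ζ(2k) = q_k π^{2k}` with `q_k = (-1)^{k+1} 2^{2k-1} B_{2k} / (2k)! ∈ ℚ`, `q_k ≠ 0`
  ("Pour `n` pair, on sait depuis Euler (1734) que `ζ(n)` est un multiple rationnel de `πⁿ`"),
  the real form of the tree's periods.S17 (`riemannZeta_two_mul_nat_mem_ratCast_mul_pi_pow`),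
  from Mathlib's `hasSum_zeta_nat`;
* `transcendental_zetaValue_two_mul` — "Il s'ensuit que ces nombres sont transcendants": from the
  tree's PROVED Lindemann theorem `Literature.NumberTheory.Transcendental.transcendental_pi_holds`;
* `not_algebraicIndependent_pi_zetaValue_two_mul` — "contrairement à ce qui précède": `π` and an
  even zeta value are algebraically dependent (the relation `q_k X₀^{2k} − X₁`), so no even value
  can join the family of periods.S21 or of the barrier's consequent.

## References

* [Fresan2024] J. Fresán, *Une introduction aux périodes*, Journées X-UPS 2019 (publ. 2024),
  Ex. 2.6 (pp. 21–22), §3.2, Thm. 7.5, §10.4 (Conj. 10.6, pp. 146–148).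
* [KontsevichZagier2001] M. Kontsevich, D. Zagier, *Periods* (2001), §1.2 Conjecture 1, §4.1.
* [HuberMullerStachPeriods2017] A. Huber, S. Müller-Stach, *Periods and Nori motives*, Springer
  (2017), Thm. 12.2.1, Conj. 13.2.1, Prop. 13.2.6.
* [Ayoub2014] J. Ayoub, *Periods and the conjectures of Grothendieck and Kontsevich–Zagier*, EMS
  Newsl. 91 (2014), Cor. 32.
* [HuberWustholz2022] A. Huber, G. Wüstholz, *Transcendence and linear relations of 1-periods*,
  CUP (2022), Prologue pp. xvi–xvii.
* [Brown2012] F. Brown, *Mixed Tate motives over `ℤ`*, Ann. of Math. 175 (2012), §3.2.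
* [Waldschmidt2004] M. Waldschmidt, *Open Diophantine problems*, Moscow Math. J. 4 (2004), §3.2
  Conj. 3.17.
* [FischlerSprangZudilin2019] S. Fischler, J. Sprang, W. Zudilin, *Many odd zeta values are
  irrational*, Compos. Math. 155 (2019), §1.

## Design notes

* Nothing of `GrothendieckPeriodConjectureDependence.lean` is restated or modified; imports: the
  barrier file, `KZKernelConjectureForms` (forms of Conjecture 1), `LindemannWeierstrassProofs`
  (`transcendental_pi_holds`), `Mathlib.NumberTheory.ZetaValues` (`hasSum_zeta_nat`).
* `zetaValue k = ∑' n : ℕ, 1 / (n : ℝ) ^ k` is literally the series of `hasSum_zeta_nat`, so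
  Euler's formula transfers by `HasSum.tsum_eq`.
-/

noncomputable section

open Literature.NumberTheory.Transcendental

namespace Literature.Barriers.KontsevichZagierPeriods

/-! ### Position of the fact: domination by the open conjecture periods.S21 -/

/-- **The fact follows from the open conjecture `PiOddZetaAlgebraicIndependent`.** If
`π, ζ(3), ζ(5), …` are algebraically independent over `ℚ` (periods.S21,
[cite: Waldschmidt2004, §3.2 Conjecture 3.17]), then so is the sub-family `ζ(3), ζ(5), …`
(`PiOddZetaAlgebraicIndependent.algebraicIndependent_zetaValue_odd`), which is the consequent of
`kzConjecture_implies_oddZetaAlgIndep`; the antecedent (the summit) is not used. The named-fact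
debt is thus dominated by an open statement, itself "predicted by Grothendieck's period
conjecture for mixed Tate motives" [cite: FischlerSprangZudilin2019, §1 (Introduction)]. -/
theorem kzConjecture_implies_oddZetaAlgIndep_of_piOddZetaAlgebraicIndependent
    (h : PiOddZetaAlgebraicIndependent) : kzConjecture_implies_oddZetaAlgIndep :=
  fun _ => h.algebraicIndependent_zetaValue_odd

/-! ### The barrier against the other forms of Conjecture 1 -/

/-- **Kernel form.** The barrier fact is equivalent to the same implication from the kernel form
of Conjecture 1, `KZKernelConjecture` (`ker KZ.eval = KZ.relations`: evaluation is injective on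
formal combinations of integral representations modulo the moves — the shape of "the evaluation
map `P̃(k) → P(k)` is bijective" [cite: HuberMullerStachPeriods2017, Conj. 13.2.1] and of
"Conjecture 10.6 (Kontsevich–Zagier). L'application per est injective"
[cite: Fresan2024, §10.4 Conjecture 10.6]), by the proved comparison
`kzKernelConjecture_iff_isRational`. -/
theorem kzConjecture_implies_oddZetaAlgIndep_iff_kernelForm :
    kzConjecture_implies_oddZetaAlgIndep ↔
      (KZKernelConjecture → AlgebraicIndependent ℚ fun n : ℕ => zetaValue (2 * n + 3)) := by
  constructor
  · intro h hk
    exact h (kzKernelConjecture_iff_isRational.mp hk)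
  · intro h hr
    exact h (kzKernelConjecture_iff_isRational.mpr hr)

/-- **All-algebraic endpoints.** The barrier fact is equivalent to the same implication from
`KZPeriodConjecture'` (Conjecture 1 for all integral representations with `ℚ`-semialgebraic data,
"rational" replaced by "algebraic" as Kontsevich–Zagier allow), by the proved comparison
`kzPeriodConjecture'_iff_isRational`. [cite: KontsevichZagier2001, §1.2 Conjecture 1] -/
theorem kzConjecture_implies_oddZetaAlgIndep_iff_algebraicForm :
    kzConjecture_implies_oddZetaAlgIndep ↔
      (KZPeriodConjecture' → AlgebraicIndependent ℚ fun n : ℕ => zetaValue (2 * n + 3)) := by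
  constructor
  · intro h hk
    exact h (kzPeriodConjecture'_iff_isRational.mp hk)
  · intro h hr
    exact h (kzPeriodConjecture'_iff_isRational.mpr hr)

/-! ### The bite, in these forms -/

/-- With the fact, a proof of Conjecture 1 (rules form, KZ-literal endpoints) proves that every
`ζ(2k+1)`, `k ≥ 1`, is **transcendental** (each member of an algebraically independent family
is, `AlgebraicIndependent.transcendental`) — open: "we do not even know the transcendence of a
single odd zeta value" [cite: FischlerSprangZudilin2019, §1 (Introduction)].
[cite: HuberWustholz2022, Prologue p. xvi] -/
theorem transcendental_zetaValue_odd_of_kz (h : kzConjecture_implies_oddZetaAlgIndep)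
    (hkz : ∀ ⦃n m : ℕ⦄ (r : KZ.IntegralRep n) (r' : KZ.IntegralRep m),
      r.IsRational → r'.IsRational → r.value = r'.value → KZ.Equivalent r r')
    {k : ℕ} (hk : 1 ≤ k) : Transcendental ℚ (zetaValue (2 * k + 1)) := by
  obtain ⟨j, rfl⟩ := Nat.exists_eq_add_of_le hk
  have h1 : Transcendental ℚ (zetaValue (2 * j + 3)) := (h hkz).transcendental j
  have e : 2 * (1 + j) + 1 = 2 * j + 3 := by ring
  rw [e]
  exact h1

/-- With the fact, the **kernel form** of Conjecture 1 (`ker eval = relations`) proves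
`OddZetaIrrational` (every `ζ(2k+1)`, `k ≥ 1`, irrational — open).
[cite: HuberWustholz2022, Prologue p. xvi] -/
theorem oddZetaIrrational_of_kzKernel (h : kzConjecture_implies_oddZetaAlgIndep)
    (hk : KZKernelConjecture) : OddZetaIrrational :=
  oddZetaIrrational_of_kz h (kzKernelConjecture_iff_isRational.mp hk)

/-- With the fact, the **kernel form** of Conjecture 1 proves `ZetaFiveIrrational` (`ζ(5) ∉ ℚ` —
open; Zudilin gives only one of `ζ(5), ζ(7), ζ(9), ζ(11)`).
[cite: HuberWustholz2022, Prologue p. xvi] -/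
theorem zetaFiveIrrational_of_kzKernel (h : kzConjecture_implies_oddZetaAlgIndep)
    (hk : KZKernelConjecture) : ZetaFiveIrrational :=
  zetaFiveIrrational_of_kz h (kzKernelConjecture_iff_isRational.mp hk)

/-! ### Proved frontier: the even zeta values (why the statement concerns the odd ones) -/

/-- **Euler (1734)**, real form of periods.S17: for `k ≠ 0`,
`ζ(2k) = (-1)^{k+1} 2^{2k-1} B_{2k} π^{2k} / (2k)!`, a rational multiple of `π^{2k}` — "Pour `n`
pair, on sait depuis Euler (1734) que `ζ(n)` est un multiple rationnel de `πⁿ`" (Mathlib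
`hasSum_zeta_nat`; `zetaValue (2k)` is literally that series). [cite: Fresan2024, Ex. 2.6] -/
theorem zetaValue_two_mul_eq {k : ℕ} (hk : k ≠ 0) :
    zetaValue (2 * k) =
      (((-1 : ℚ) ^ (k + 1) * 2 ^ (2 * k - 1) * bernoulli (2 * k) / (2 * k).factorial : ℚ) : ℝ) *
        Real.pi ^ (2 * k) := by
  rw [zetaValue, (hasSum_zeta_nat hk).tsum_eq]
  push_cast
  ring

/-- `ζ(2k) > 0` for `k ≠ 0`: a convergent series of non-negative terms whose `n = 1` term is `1`.
[folklore] -/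
theorem zetaValue_two_mul_pos {k : ℕ} (hk : k ≠ 0) : 0 < zetaValue (2 * k) := by
  have hs : Summable (fun n : ℕ => 1 / (n : ℝ) ^ (2 * k)) := (hasSum_zeta_nat hk).summable
  refine hs.tsum_pos (fun n => by positivity) 1 ?_
  simp

/-- **Euler**, as printed: for `k ≠ 0` there is a *non-zero* rational `q` with `ζ(2k) = q π^{2k}`
("`ζ(n)` est un multiple rationnel de `πⁿ`"; `q ≠ 0` since `ζ(2k) > 0`). [cite: Fresan2024, Ex. 2.6] -/
theorem exists_rat_ne_zero_zetaValue_two_mul_eq {k : ℕ} (hk : k ≠ 0) :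
    ∃ q : ℚ, q ≠ 0 ∧ zetaValue (2 * k) = (q : ℝ) * Real.pi ^ (2 * k) := by
  refine ⟨_, ?_, zetaValue_two_mul_eq hk⟩
  intro hq
  have h := zetaValue_two_mul_eq hk
  rw [hq, Rat.cast_zero, zero_mul] at h
  exact (zetaValue_two_mul_pos hk).ne' h

/-- **The even zeta values are transcendental** — "Il s'ensuit que ces nombres sont
transcendants": `ζ(2k) = q π^{2k}` with `q ∈ ℚˣ`, and `π` is transcendental (Lindemann; the tree's
proved `Literature.NumberTheory.Transcendental.transcendental_pi_holds`), so `π^{2k}` and hence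
`ζ(2k)` are. [cite: Fresan2024, Ex. 2.6] -/
theorem transcendental_zetaValue_two_mul {k : ℕ} (hk : k ≠ 0) :
    Transcendental ℚ (zetaValue (2 * k)) := by
  obtain ⟨q, hq0, hq⟩ := exists_rat_ne_zero_zetaValue_two_mul_eq hk
  intro halg
  have hq0' : (q : ℝ) ≠ 0 := Rat.cast_ne_zero.mpr hq0
  have hpow : IsAlgebraic ℚ (Real.pi ^ (2 * k)) := by
    have e : Real.pi ^ (2 * k) = (q⁻¹ : ℚ) • zetaValue (2 * k) := by
      rw [Algebra.smul_def, eq_ratCast, Rat.cast_inv, hq, ← mul_assoc, inv_mul_cancel₀ hq0',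
        one_mul]
    rw [e]
    exact halg.smul _
  have hpi : Transcendental ℚ Real.pi := transcendental_pi_holds
  exact hpi (hpow.of_pow (by omega))

/-- **`π` and an even zeta value are algebraically dependent** ("contrairement à ce qui précède":
the odd values are conjectured NOT to be algebraically related to `π`): for `k ≠ 0` the pair
`(π, ζ(2k))` annihilates the non-zero polynomial `q X₀^{2k} − X₁`, `q` as in Euler's formula; so no
even zeta value can be adjoined to the family `π, ζ(3), ζ(5), …` of periods.S21, nor to the
consequent of `kzConjecture_implies_oddZetaAlgIndep`. [cite: Fresan2024, Ex. 2.6] -/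
theorem not_algebraicIndependent_pi_zetaValue_two_mul {k : ℕ} (hk : k ≠ 0) :
    ¬ AlgebraicIndependent ℚ ![Real.pi, zetaValue (2 * k)] := by
  obtain ⟨q, -, hq⟩ := exists_rat_ne_zero_zetaValue_two_mul_eq hk
  intro h
  have hrel : MvPolynomial.aeval ![Real.pi, zetaValue (2 * k)]
      (MvPolynomial.C q * MvPolynomial.X 0 ^ (2 * k) - MvPolynomial.X 1 :
        MvPolynomial (Fin 2) ℚ) = 0 := by
    simp [hq]
  have hzero := (algebraicIndependent_iff.mp h) _ hrel
  -- the coefficient of `X₁` in `q X₀^{2k} − X₁` is `−1`, not `0`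
  have hne : Finsupp.single (0 : Fin 2) (2 * k) ≠ Finsupp.single 1 1 := by
    intro heq
    have h1 := DFunLike.congr_fun heq 1
    simp at h1
  have hcoeff := congrArg (MvPolynomial.coeff (Finsupp.single (1 : Fin 2) 1)) hzero
  rw [MvPolynomial.coeff_sub, MvPolynomial.coeff_C_mul, MvPolynomial.coeff_X_pow, if_neg hne,
    MvPolynomial.coeff_X, MvPolynomial.coeff_zero] at hcoeff
  norm_num at hcoeff

end Literature.Barriers.KontsevichZagierPeriods
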